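import Summits.AtomisticToContinuum.FouriersLaw.Theorems.BondHeatUncertaintyBoundedResponseBathHeatHorizonReturnD
import HarnessLib
/-!
# NODE 112 «HorizonReturn» — the late bath tail through a POLYNOMIAL HORIZON and a CONFINED heat-return curve

Cell `decomp-a2c`, lens-1 («grading / quantitative ladder»), generation 112, RESIDUAL MODE. Target (blocker of record):
`Summit.AtomisticToContinuum.FouriersLaw.Theses.BondHeatUncertainty.BoundedResponse` (stmt-AtomisticToContinuum-11071); residual beneath
(S) `SubdiffusiveBondHeat`: `LateTailFloor a 1 1` (NODE 109/111; door `boundedResponse_of_subdiffusiveBondHeat_lateTailFloor`).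
Main file (part 5 of 5) of the chain `…BathHeatHorizonReturnA` (§1–§2) → `…B` (§3) → `…C` (§4–§5) → `…D` (§6) → this file (§7 + overview); the chain imports
only the tree (NODE 111 parts A/B `…BathHeatHeatReturnA/B`, hence NODE 108–110 and the LateTail files). 0 `sorry`.

## The node (every non-piece arrow PROVED in this file)

Fix `q ∈ ℕ`, `q ≥ 3` (HORIZON EXPONENT) and `δ > 0` (CONFINEMENT EXPONENT). For `N = n+1`, `s = aN`, `t = cN²`, `τ = N^q ≥ max(t, 2s)`:

* ★ HORIZON SPLIT (`bathTailLate_eq_horizon`): `B^late_N(s,t) = γ²·∫ θ₀·U^{s,t;τ}_N dμ_T + γ²·t·Rem_N(τ)`, where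
  `U^{s,t;τ}_N(z) = ∫_{(0,τ]} ℓ_{s,t}(u)·(P_u θ₀)(z) du` (`horizonCumFcast`, FINITE-TIME) and `Rem_N(τ) = ∫_{(τ,∞)} K_N` (`bathKinRem`, the ONLY
  infinite-time quantity); past the horizon the late weight is the constant `t`.
* ★ DOOR, pointwise (`bathTailLate_ge_horizon`): `B^late_N(s,t) ≥ −γ²·𝔇_T(𝔊^{s,t;τ}_N) + γ²·t·Rem_N(τ)` with the HORIZON HEAT-RETURN CURVE
  `𝔊^{s,t;τ}_N(k) = ∫ U^{s,t;τ}_N(q, p[0 ↦ k]) dμ_T` (`horizonReturnProfile`; NODE 111's Stein/crossing-defect floor applied to `U^τ`).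
* ★ FREE BUDGET (`integral_horizonCumFcast_sq_le`, `horizonReturnProfile_sq_le`): `∫(𝔊^{s,t;τ}_N)² dν_T ≤ ∫(U^{s,t;τ}_N)² dμ_T ≤
  (|t|+4|s|)²·τ²·∫(k²−T)² dν_T` — Jensen for kick averages (`integral_kickAvg_sq_le`: the kick average is a conditional expectation, `p₀` being an
  independent `N(0,T)` coordinate of `μ_T` — «Gaussian cheapness»), Cauchy–Schwarz in `u`, Fubini, `L²(μ_T)`-contraction of `P_u`, and
  `∫θ₀² dμ_T = ∫(k²−T)² dν_T` (`integral_kinObs_sq_eq_gaussT`). NO spectral gap, NO corrector budget (KCB), NO Harris constant enters a bound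
  (Harris–Rey-Bellet constants are used for integrability only).
* ★ CONFINEMENT LEMMA (`thermalCrossDefect_le_of_monotoneSqOn`, pure 1-D Gaussian): if `g ∈ L²(ν_T)` is nondecreasing in `k²` on `k² ≤ κ²`
  (`κ² ≥ 4T`) then `𝔇_T(g) ≤ A_{T,j}·κ^{−2j}·(1 + ∫g² dν_T)` for EVERY `j ∈ ℕ` (comparison curve = `g` frozen at `±κ` outside, single-crossing
  admissible; Gaussian moments pay `κ^{−2j}`; weighted AM–GM, no square roots).
* PIECES (the only open arrows), both `Prop`s over tree objects:
  - `(HZᶠ_{q,g})` `HorizonRemainderFloor q g`: eventually `−C·N^g ≤ γ²N²·Rem_N(N^q)`. Door grade `g = 1`. Tags: UNDECIDED · INSTRUMENTABLE (it is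
    a statement about `K_N` on `(N^q, ∞)` only) · IDEA-NEEDED (polynomial-time mixing of ONE boundary autocorrelation; no rate, no gap) · phonon-TRUE
    (`K_N ≥ 0`). FREE at `g = q+2` (`horizonRemainderFloor_free`, from `∫_{(0,∞)}K_N ≥ 0` = `escapeDeficit ≤ 1` and `|K_N| ≤ 2T²`); the open
    content is exactly the exponent range `g < q+2`. WHY STRICTLY WEAKER than the target: blind to every lag `r ≤ N^q`, where the whole Ohmic `−cN`
    signal lives (NODE 109 light cone, NODE 111 echo window) — MustFail probes M1/M5/M6 of `probes/MustFail112.lean`.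
  - `(HM_{a,q,δ})` `HorizonReturnMonotoneOn a q δ`: eventually `𝔊^{aN,cN²;N^q}_N` agrees `ν_T`-a.e. with a function nondecreasing in `k²` ON THE
    CONFINED THERMAL RANGE `k² ≤ T·N^δ` ONLY. Tags: UNDECIDED · INSTRUMENTABLE (⟸ confined pointwise (ER↑) within the horizon,
    `horizonReturnMonotoneOn_of_kinKickProfile_monoOn`, = census KICK readouts `Ḡ_{N,u}(k)`, `aN < u ≤ N^q`, `k² ≤ T N^δ`) · IDEA-NEEDED
    (a comparison / coupling principle for the kicked boundary particle: "kicked harder — within `N^{δ/2}` thermal widths — returns more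
    late-weighted heat within the horizon") · phonon-TRUE (exact parabola, NODE 110 `kickProfiles_harmonic`). WHY WEAKER than NODE 111's `(HR↑_a)`
    (`LateHeatReturnMonotone a`): NOTHING is asked at hard kicks `k² > T·N^δ` (the regime where the quartic pinning detunes the boundary oscillator
    out of the phonon band — NODE 111's named failure mode «hard-kick saturation» is REMOVED BY A THEOREM, the confinement lemma) and nothing after
    the horizon. MustFail probes M2/M4/M7/M8 of `probes/MustFail112.lean`.
* ★★★ THE DOOR (`lateTailFloor_one_of_horizon`; `boundedResponse_of_subdiffusiveBondHeat_horizon`; `horizonReturnLadder`): for `0 ≤ a`, `3 ≤ q`,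
  `0 < δ`: `(HZᶠ_{q,1}) ∧ (HM_{a,q,δ}) ⟹ LateTailFloor a 1 1`, hence with (S) the blocker 11071. Bookkeeping: budget `O(N^{2q+4})` against confinement
  gain `(T N^δ)^{−j}` with `j ≥ (2q+4)/δ` ⟹ `γ²𝔇 = O(1)`; remainder `≥ −cC₁N`.
* LITERATURE-TYPED FEEDER of `(HZᶠ)` (§7): `(KD_p)` `BathKernelHorizonDecay p` — `|K_N(r)| ≤ C·N^m·e^{−c r/N^p}` eventually (ONE boundary
  autocorrelation relaxing at the `N`-POLYNOMIAL rate `N^{−p}`; the shape of [BeckerMenegaki2022] (harmonic: sharp gap `≍ N^{−3}`, so `p = 3` is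
  the phonon value), [Menegaki2020] and [Lu 2026, arXiv:2607.13953, Thm 2.6(iii)] (weakly anharmonic: entropy decay at rate `c*/N³`); OPEN for
  the quartic conjunct). ★ `horizonRemainderFloor_of_kernelDecay`: `(KD_p) ⟹ (HZᶠ_{q,g})` for every `q > p` and EVERY `g`; hence
  `(KD_p) ∧ (HM_{a,q,δ}) ⟹ LateTailFloor a 1 1` (`q ≥ 3`, `q > p`; `lateTailFloor_one_of_kernelDecay_horizonMonotone`, `kernelDecayLadder`).
  The barrier `SpectralGapClosingEquilibrium` (rate `≤ 4√2γ ln(2C)/√N`) forbids only `p < 1/2`: EVADED by the free horizon exponent.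

## Why this is new (lineage deltas) and why it is the lens

NODE 106/108 split the bath tail at the THOULESS time `cN²` and met the hydrodynamic remainder head-on; NODE 111 floored the late functional by the
crossing defect of the INFINITE-horizon curve `𝔊^{s,t}_N`, whose `L²` control needs the uniform-in-time corrector budget (KCB, open) and whose
monotonicity is asked at ALL kick energies. NODE 112 grades both axes: a free POLYNOMIAL HORIZON `N^q` (all infinite-time content collapses into the
scalar `(HZᶠ)`, and below the horizon the budget is a THEOREM at every `q`) and a free CONFINEMENT RADIUS `T·N^δ` (monotonicity asked on a growing
but thermal range only; the price `N^{2q+4}` is paid by Gaussian moments, a THEOREM at every `δ`). The two exponents trade against each other only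
through `j`, which is free: the ladder `(q, δ) ∈ ℕ_{≥3} × (0,∞)` is totally ordered in strength on each axis (`HorizonRemainderFloor.mono`; `(HM)`
weakens as `δ ↓ 0` and as `q ↓`; `(HZᶠ)` weakens as `q ↑`), and EVERY rung's door is proved here at once.

## Barriers (catalogue `Literature/Barriers/AtomisticToContinuum/`)

- technique_class: equilibrium fluctuation functional / Stein–Gaussian comparison at the bath site / finite-horizon semigroup estimates.
- `SpectralGapClosing`, `SpectralGapClosingEquilibrium`: OUTSIDE — no `N`-uniform rate is used or asked; the horizon is polynomial with a FREE
  exponent `q`, and `(HZᶠ)` is one-sided (slow POSITIVE relaxation of `K_N` is harmless). The bet: the far tail of ONE boundary autocorrelation has no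
  negative mass `≫ 1/(γ²N)` beyond SOME polynomial time. Quantitatively (§7): `equilibrium_rate_bound` caps any exponential rate at `O(γ ln N/√N)`,
  i.e. it excludes `(KD_p)` only for `p < 1/2`, while `(KD_p)` for ANY `p` feeds `(HZᶠ_{q,·})` with `q > p` — the closing gap is priced, not fought.
- `BoundaryTapNormPersistence`: OUTSIDE its quantifier — `θ₀ = p₀² − T` is a ONE-SITE observable AT the tap, not an extensive sum; the budget used
  is the trivial contraction, not a drained norm.
- `StrongPinningBreathers`, `AnticontinuumLocalization`: the conjunct's pinning and coupling are both quartic (not pinning-dominated); breather-type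
  slow relaxation threatens `(HZᶠ)` only through a NEGATIVE far-tail echo, and `(HM)` only through hard kicks — which the confinement exponent `δ`
  excludes (`k² ≤ T N^δ`, `δ` as small as desired).
- `LowTemperatureWeakAnharmonicity` / `HarmonicCrystalBallistic`: at the harmonic point both pieces are TRUE (`K_N ≥ 0`; exact parabola), so the
  node is phonon-compatible (critic doctrine row 1491) — the open content is genuinely anharmonic and carries no decay RATE.

## Named failure modes (what would kill each piece)

`(HZᶠ_{q,1})`: a negative far-tail lobe of `K_N` of mass `≥ N^{−1+ε}/γ²` surviving beyond EVERY polynomial horizon (quasi-periodic boundary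
recurrences that never average out). `(HM_{a,q,δ})`: within the thermal range `k² ≤ T N^δ` and at late-but-pre-horizon lags, a HARDER kick returning
LESS late-weighted heat (nonlinear resonance windows of the boundary oscillator inside the phonon band). Instrument: census KICK curves
`Ḡ_{N,u}(k)` restricted to `k² ≤ T N^δ`, `u ≤ t_max`.

## Contents

§1 elementary integral inequalities (Jensen, Cauchy–Schwarz, weighted AM–GM) · §2 the 1-D thermal Gaussian and ★ the CONFINEMENT LEMMA · §3 finite-horizon
objects, measurability/integrability, `∫θ₀² = ∫(k²−T)²dν_T`, ★ Jensen for kick averages, ★ FREE BUDGET · §4 ★ HORIZON SPLIT, ★ pointwise DOOR, budget of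
the curve · §5 the pieces, grade monotonicity, `∫_{(0,∞)}K_N ≥ 0`, `Rem_N(τ) ≥ −2T²τ`, ★ FREE RUNG, ★★★ THE DOOR, corollary on 11071 · §6 profile formula
`𝔊^{s,t;τ}_N(k) = ∫_{(0,τ]} ℓ(Ḡ_{N,u}(k) − T) du`, confined comparison with NODE 110, ★ `(HM)` ⟸ confined pointwise (ER↑), LADDER · §7 the
literature-typed feeder `(KD_p)`, rate monotonicity, `N^A e^{−cN^ε} ≤ 1` eventually, ★ `(KD_p) ⟹ (HZᶠ_{q,g})` (`q > p`), the fed door, LADDER.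
Landing cut (≤ 400 lines each, `probes/split112.py`): `…BathHeatHorizonReturnA` (§1–§2) → `…B` (§3) → `…C` (§4–§5) → `…D` (§6) →
`…BathHeatHorizonReturn` (§7, main; carries this overview).
-/

noncomputable section

open MeasureTheory ProbabilityTheory Filter Topology Set Function
open scoped NNReal ENNReal
open Literature.MathematicalPhysics.KineticTheory.HeatConduction
open Literature.MathematicalPhysics.KineticTheory OscillatorChain
open Literature.Probability.Process
open Summit.AtomisticToContinuum.FouriersLaw.Theorems.OddSectorIrreversibility
  (pinnedChain_stronglyMeasurable_act_uncurry pinnedChain_integral_sq_act_le_of_stronglyMeasurable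
    pinnedChain_integrable_transitionKernel_of_abs_le integral_exp_neg_mul_Ioi' integrable_mul_of_integrable_sq)
open Summit.AtomisticToContinuum.FouriersLaw.Theorems.BoundedResponse.ParityFloor
  (kinObs kinAct continuous_kinObs abs_kinObs_le stronglyMeasurable_kinAct abs_kinAct_le kinAct_integrableOn
    harrisBound_exists weight_facts kinObs_sq_facts)

namespace Summit.AtomisticToContinuum.FouriersLaw.Theorems.BoundedResponse.HeatSpreading

/-! ## §7 A LITERATURE-TYPED SUFFICIENT CONDITION FOR `(HZᶠ)`: polynomial-rate exponential decay of the bath kernel -/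

section KernelDecay

/-- **(KD_p) `BathKernelHorizonDecay p`** — POLYNOMIAL-RATE EXPONENTIAL DECAY OF THE BOUNDARY KINETIC AUTOCORRELATION: for all parameters
there are `C, m` and `c > 0` with, eventually in `N`, `|K_N(r)| ≤ C·N^m·e^{−c·r/N^p}` for all `r ≥ 0` — relaxation of ONE boundary observable
(`θ₀ = p₀² − T`) at the `N`-POLYNOMIAL rate `N^{−p}` with a polynomial prefactor. This is the shape in which the literature states
quantitative ergodicity of boundary-driven chains: homogeneous pinned HARMONIC chain — sharp spectral gap `≍ N^{−3}` [BeckerMenegaki2022]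
(so `p = 3` is the phonon value); WEAKLY ANHARMONIC chains (bounded, small Hessian perturbations of it) — Wasserstein / entropy decay at rate
`c·N^{−3}` [Menegaki2020; Lu 2026, arXiv:2607.13953, Thm 2.6(iii): `Ent(P*_t f) ≤ 2e^{−c* t/N³}·Ent(f)`]; the conjunct's quartic chain
(`lam, β > 0`, unbounded Hessian) — OPEN [BeckerMenegaki2022, §1.3]. The catalogued barrier
`Literature.Barriers.AtomisticToContinuum.SpectralGapClosingEquilibrium` (`equilibrium_rate_bound`: every `L²` rate is `≤ 4√2·γ·ln(2C)/√N`)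
forbids only `p < 1/2` — it is EVADED, not beaten: the rate is allowed to close polynomially, which costs nothing here because the horizon
exponent `q` of `(HZᶠ_{q,g})` is free (`horizonRemainderFloor_of_kernelDecay`: `(KD_p) ⟹ (HZᶠ_{q,g})` for every `q > p` and EVERY grade `g`).
Tags: UNDECIDED (at `lam, β > 0`) · LITERATURE-FED (not instrumentable past Thouless lags: census BKER-110 `S(N²) = 1 ± 0.06`) · phonon-TRUE
with `p = 3` · for `p ≥ 2` blind to the whole late window `r ≲ N²` (says nothing about the target's `−cN`; MustFail probes M10–M12).
[route statement · this cell; NOT a literature fact] -/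
def BathKernelHorizonDecay (p : ℝ) : Prop :=
  ∀ ω₂ lam β γ : ℝ, 0 < ω₂ → 0 < lam → 0 < β → 0 < γ → ∀ T : ℝ, 0 < T →
    ∃ C m c : ℝ, 0 < c ∧ ∃ N₀ : ℕ, ∀ N : ℕ, N₀ ≤ N → ∀ r : ℝ, 0 ≤ r →
      |bathKinCorr ω₂ lam β γ T N r| ≤ C * (N : ℝ) ^ m * Real.exp (-(c * r / (N : ℝ) ^ p))

/-- Rate monotonicity of `(KD)`: a faster polynomial rate implies a slower one (`p ≤ p'`). [formal bookkeeping] -/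
theorem BathKernelHorizonDecay.mono {p p' : ℝ} (hpp' : p ≤ p') (h : BathKernelHorizonDecay p) : BathKernelHorizonDecay p' := by
  intro ω₂ lam β γ hω hl hβ hγ T hT
  obtain ⟨C, m, c, hc, N₀, hK⟩ := h ω₂ lam β γ hω hl hβ hγ T hT
  refine ⟨C, m, c, hc, max N₀ 1, fun N hN r hr => (hK N (le_trans (le_max_left _ _) hN) r hr).trans ?_⟩
  have hN1 : (1 : ℝ) ≤ (N : ℝ) := by exact_mod_cast le_trans (le_max_right _ _) hN
  have hN0 : (0 : ℝ) < N := by linarith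
  have hCm : 0 ≤ C * (N : ℝ) ^ m := by
    have h0 := (abs_nonneg _).trans (hK N (le_trans (le_max_left _ _) hN) 0 le_rfl)
    simpa using h0
  refine mul_le_mul_of_nonneg_left (Real.exp_le_exp.2 ?_) hCm
  have hpow : (N : ℝ) ^ p ≤ (N : ℝ) ^ p' := Real.rpow_le_rpow_of_exponent_le hN1 hpp'
  have hp0 : 0 < (N : ℝ) ^ p := Real.rpow_pos_of_pos hN0 _
  have : c * r / (N : ℝ) ^ p' ≤ c * r / (N : ℝ) ^ p :=
    div_le_div_of_nonneg_left (by positivity) hp0 hpow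
  linarith

/-- Polynomial × stretched-exponential decay is eventually `≤ 1` along the naturals: `N^A·e^{−c·N^ε} ≤ 1` for `N ≥ N₁(A,c,ε)`
(`c, ε > 0`; from `log =o(x^ε)`). [elementary] -/
theorem eventually_rpow_mul_exp_neg_le_one (A : ℝ) {c ε : ℝ} (hc : 0 < c) (hε : 0 < ε) :
    ∃ N₁ : ℕ, ∀ N : ℕ, N₁ ≤ N → (N : ℝ) ^ A * Real.exp (-(c * (N : ℝ) ^ ε)) ≤ 1 := by
  have hκ : 0 < c / (|A| + 1) := by positivity
  have h := (isLittleO_log_rpow_atTop hε).bound hκ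
  obtain ⟨X, hX⟩ := Filter.eventually_atTop.1 (h.and (Filter.eventually_ge_atTop 1))
  obtain ⟨N₁, hN₁⟩ := exists_nat_ge X
  refine ⟨max N₁ 1, fun N hN => ?_⟩
  have hNX : X ≤ (N : ℝ) := hN₁.trans (by exact_mod_cast le_trans (le_max_left _ _) hN)
  obtain ⟨hlog, h1⟩ := hX (N : ℝ) hNX
  have hN0 : (0 : ℝ) < N := by linarith
  rw [Real.norm_eq_abs, Real.norm_eq_abs, abs_of_nonneg (Real.log_nonneg h1),
    abs_of_nonneg (Real.rpow_nonneg hN0.le _)] at hlog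
  rw [Real.rpow_def_of_pos hN0, ← Real.exp_add]
  apply Real.exp_le_one_iff.2
  have hlogN : 0 ≤ Real.log N := Real.log_nonneg h1
  have hA : Real.log N * A ≤ |A| * Real.log N := by
    rw [mul_comm]; exact mul_le_mul_of_nonneg_right (le_abs_self A) hlogN
  have h2 : |A| * Real.log N ≤ |A| * (c / (|A| + 1) * (N : ℝ) ^ ε) := mul_le_mul_of_nonneg_left hlog (abs_nonneg A)
  have h3 : |A| * (c / (|A| + 1) * (N : ℝ) ^ ε) ≤ c * (N : ℝ) ^ ε := by
    have hpow : 0 ≤ (N : ℝ) ^ ε := Real.rpow_nonneg hN0.le _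
    have : |A| * (c / (|A| + 1)) ≤ c := by
      rw [mul_div_assoc', div_le_iff₀ (by positivity)]; nlinarith [abs_nonneg A]
    calc |A| * (c / (|A| + 1) * (N : ℝ) ^ ε) = (|A| * (c / (|A| + 1))) * (N : ℝ) ^ ε := by ring
      _ ≤ c * (N : ℝ) ^ ε := mul_le_mul_of_nonneg_right this hpow
  linarith

variable {ω₂ lam β γ T : ℝ}

/-- **Horizon remainder under exponential kernel decay** (`N ≥ 1`, `τ ≥ 0`, `κ > 0`): if `|K_N(r)| ≤ D·e^{−κr}` for `r > τ` then
`Rem_N(τ) ≥ −(D/κ)·e^{−κτ}`. [this cell, cheap] -/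
theorem bathKinRem_ge_of_expDecay (hω : 0 < ω₂) (hl : 0 < lam) (hβ : 0 < β) (hγ : 0 < γ) (hT : 0 < T) {N : ℕ} (hN : 0 < N)
    {D κ τ : ℝ} (hκ : 0 < κ) (hτ : 0 ≤ τ) (hK : ∀ r : ℝ, τ < r → |bathKinCorr ω₂ lam β γ T N r| ≤ D * Real.exp (-κ * r)) :
    -(D / κ * Real.exp (-κ * τ)) ≤ bathKinRem ω₂ lam β γ T N τ := by
  obtain ⟨-, -, hKI⟩ := bathKinCorr_basics hω hl hβ hγ hT hN
  have hEI : IntegrableOn (fun r => D * Real.exp (-κ * r)) (Ioi τ) := (exp_neg_integrableOn_Ioi τ hκ).const_mul D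
  have hmono : ∫ r in Ioi τ, -(D * Real.exp (-κ * r)) ≤ bathKinRem ω₂ lam β γ T N τ := by
    unfold bathKinRem
    refine setIntegral_mono_on hEI.neg (hKI.mono_set (Ioi_subset_Ioi hτ)) measurableSet_Ioi fun r hr => ?_
    have h := hK r hr
    exact neg_le_of_abs_le h
  have hval : ∫ r in Ioi τ, -(D * Real.exp (-κ * r)) = -(D / κ * Real.exp (-κ * τ)) := by
    rw [integral_neg, integral_const_mul, integral_exp_mul_Ioi (by linarith : -κ < 0) τ]
    field_simp
  linarith [hmono, hval.symm.le, hval.le]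

/-- ★ **`(KD_p) ⟹ (HZᶠ_{q,g})` for every horizon exponent `q > p` and EVERY grade `g`**: past the horizon `N^q` a kernel decaying at rate
`c·N^{−p}` leaves the super-polynomially small remainder `|Rem_N(N^q)| ≤ (C/c)·N^{m+p}·e^{−c·N^{q−p}}`. So the horizon-remainder piece of the
door is fed by ANY polynomial-in-`N` quantitative ergodicity statement for the one boundary observable `θ₀` — the literature's programme
(harmonic: [BeckerMenegaki2022]; weakly anharmonic: [Menegaki2020], [Lu 2026, arXiv:2607.13953]) — with no `N`-uniformity asked. [this cell] -/
theorem horizonRemainderFloor_of_kernelDecay {p : ℝ} {q : ℕ} (hpq : p < q) (h : BathKernelHorizonDecay p) (g : ℝ) :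
    HorizonRemainderFloor q g := by
  intro ω₂ lam β γ hω hl hβ hγ T hT
  obtain ⟨C, m, c, hc, N₀, hK⟩ := h ω₂ lam β γ hω hl hβ hγ T hT
  obtain ⟨N₁, hN₁⟩ := eventually_rpow_mul_exp_neg_le_one (m + p + 2 - g) hc (sub_pos.2 hpq)
  refine ⟨γ ^ 2 * (C / c), max (max N₀ 1) N₁, fun N hN => ?_⟩
  have hNN₀ : N₀ ≤ N := le_trans (le_trans (le_max_left _ _) (le_max_left _ _)) hN
  have hN1' : 1 ≤ N := le_trans (le_trans (le_max_right _ _) (le_max_left _ _)) hN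
  have hNN₁ : N₁ ≤ N := le_trans (le_max_right _ _) hN
  have hN0 : (0 : ℝ) < N := by exact_mod_cast hN1'
  have hNpos : 0 < N := hN1'
  -- constants at this `N`
  obtain ⟨b, hb⟩ : ∃ b : ℝ, b = (N : ℝ) ^ p := ⟨_, rfl⟩
  have hb0 : 0 < b := by rw [hb]; exact Real.rpow_pos_of_pos hN0 _
  obtain ⟨D, hD⟩ : ∃ D : ℝ, D = C * (N : ℝ) ^ m := ⟨_, rfl⟩
  have hD0 : 0 ≤ D := by
    have h0 := (abs_nonneg _).trans (hK N hNN₀ 0 le_rfl)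
    rw [hD]; simpa using h0
  have hC0 : 0 ≤ C := by
    have hm0 : 0 < (N : ℝ) ^ m := Real.rpow_pos_of_pos hN0 _
    rw [hD] at hD0
    exact le_of_mul_le_mul_right (by simpa using hD0) hm0
  have hτ0 : (0 : ℝ) ≤ (N : ℝ) ^ q := by positivity
  -- pointwise exponential bound past the horizon, in the form `D·e^{−κ r}` with `κ = c/b`
  have hκ : 0 < c / b := by positivity
  have hKexp : ∀ r : ℝ, (N : ℝ) ^ q < r → |bathKinCorr ω₂ lam β γ T N r| ≤ D * Real.exp (-(c / b) * r) := by
    intro r hr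
    have h1 := hK N hNN₀ r (hτ0.trans hr.le)
    rw [hD]
    have : -(c * r / (N : ℝ) ^ p) = -(c / b) * r := by rw [hb]; ring
    rwa [this] at h1
  have hRem := bathKinRem_ge_of_expDecay hω hl hβ hγ hT hNpos hκ hτ0 hKexp
  -- the exponent: `(c/b)·N^q = c·N^{q−p}`
  have hexp : (c / b) * (N : ℝ) ^ q = c * (N : ℝ) ^ ((q : ℝ) - p) := by
    rw [hb, Real.rpow_sub hN0, Real.rpow_natCast]; ring
  -- `N²·D/κ = (C/c)·N^{m+p+2}`
  have hpoly : (N : ℝ) ^ 2 * (D / (c / b)) = C / c * (N : ℝ) ^ (m + p + 2) := by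
    rw [hD, hb, Real.rpow_add hN0, Real.rpow_add hN0, show ((2 : ℝ)) = ((2 : ℕ) : ℝ) by norm_num, Real.rpow_natCast]
    field_simp
  -- `N^{m+p+2}·e^{−cN^{q−p}} ≤ N^g`
  have hsmall : (N : ℝ) ^ (m + p + 2) * Real.exp (-(c * (N : ℝ) ^ ((q : ℝ) - p))) ≤ (N : ℝ) ^ g := by
    have h1 := hN₁ N hNN₁
    have hsplit : (N : ℝ) ^ (m + p + 2) = (N : ℝ) ^ g * (N : ℝ) ^ (m + p + 2 - g) := by
      rw [← Real.rpow_add hN0]; ring_nf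
    rw [hsplit, mul_assoc]
    have hg0 : 0 ≤ (N : ℝ) ^ g := Real.rpow_nonneg hN0.le _
    calc (N : ℝ) ^ g * ((N : ℝ) ^ (m + p + 2 - g) * Real.exp (-(c * (N : ℝ) ^ ((q : ℝ) - p)))) ≤ (N : ℝ) ^ g * 1 :=
          mul_le_mul_of_nonneg_left h1 hg0
      _ = (N : ℝ) ^ g := mul_one _
  -- assemble
  have hmain : -(γ ^ 2 * (C / c) * (N : ℝ) ^ g) ≤
      γ ^ 2 * (N : ℝ) ^ 2 * (-(D / (c / b) * Real.exp (-(c / b) * (N : ℝ) ^ q))) := by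
    have hE : Real.exp (-(c / b) * (N : ℝ) ^ q) = Real.exp (-(c * (N : ℝ) ^ ((q : ℝ) - p))) := by
      rw [neg_mul, hexp]
    rw [hE]
    have hE1 : (N : ℝ) ^ 2 * (D / (c / b)) * Real.exp (-(c * (N : ℝ) ^ ((q : ℝ) - p))) =
        C / c * (N : ℝ) ^ (m + p + 2) * Real.exp (-(c * (N : ℝ) ^ ((q : ℝ) - p))) := by rw [hpoly]
    have : γ ^ 2 * (N : ℝ) ^ 2 * (-(D / (c / b) * Real.exp (-(c * (N : ℝ) ^ ((q : ℝ) - p))))) =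
        -(γ ^ 2 * (C / c) * ((N : ℝ) ^ (m + p + 2) * Real.exp (-(c * (N : ℝ) ^ ((q : ℝ) - p))))) := by
      calc γ ^ 2 * (N : ℝ) ^ 2 * (-(D / (c / b) * Real.exp (-(c * (N : ℝ) ^ ((q : ℝ) - p)))))
            = -(γ ^ 2 * ((N : ℝ) ^ 2 * (D / (c / b)) * Real.exp (-(c * (N : ℝ) ^ ((q : ℝ) - p))))) := by ring
        _ = -(γ ^ 2 * (C / c * (N : ℝ) ^ (m + p + 2) * Real.exp (-(c * (N : ℝ) ^ ((q : ℝ) - p))))) := by rw [hE1]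
        _ = -(γ ^ 2 * (C / c) * ((N : ℝ) ^ (m + p + 2) * Real.exp (-(c * (N : ℝ) ^ ((q : ℝ) - p))))) := by ring
    rw [this, neg_le_neg_iff]
    exact mul_le_mul_of_nonneg_left hsmall (by positivity)
  have hγ2 : 0 ≤ γ ^ 2 * (N : ℝ) ^ 2 := by positivity
  calc -(γ ^ 2 * (C / c) * (N : ℝ) ^ g)
        ≤ γ ^ 2 * (N : ℝ) ^ 2 * (-(D / (c / b) * Real.exp (-(c / b) * (N : ℝ) ^ q))) := hmain
    _ ≤ γ ^ 2 * (N : ℝ) ^ 2 * bathKinRem ω₂ lam β γ T N ((N : ℝ) ^ q) := mul_le_mul_of_nonneg_left hRem hγ2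

/-- ★ **THE DOOR FED BY KERNEL DECAY**: `0 ≤ a`, `3 ≤ q`, `p < q`, `0 < δ`: `(KD_p) ∧ (HM_{a,q,δ}) ⟹ LateTailFloor a 1 1`, and with (S) the
blocker 11071. [this cell] -/
theorem lateTailFloor_one_of_kernelDecay_horizonMonotone {a δ p : ℝ} {q : ℕ} (ha : 0 ≤ a) (hq : 3 ≤ q) (hpq : p < q) (hδ : 0 < δ)
    (hK : BathKernelHorizonDecay p) (hM : HorizonReturnMonotoneOn a q δ) : LateTailFloor a 1 1 :=
  lateTailFloor_one_of_horizon ha hq hδ (horizonRemainderFloor_of_kernelDecay hpq hK 1) hM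

/-- `boundedResponse_of_subdiffusiveBondHeat_kernelDecay_horizonMonotone` (docstring added by the landing lane; see the module docstring). [formal bookkeeping] -/
theorem boundedResponse_of_subdiffusiveBondHeat_kernelDecay_horizonMonotone {a δ p : ℝ} {q : ℕ} (ha : 0 ≤ a) (hq : 3 ≤ q)
    (hpq : p < q) (hδ : 0 < δ) (hS : Theses.BondHeatUncertainty.SubdiffusiveBondHeat)
    (hK : BathKernelHorizonDecay p) (hM : HorizonReturnMonotoneOn a q δ) : Theses.BondHeatUncertainty.BoundedResponse :=
  boundedResponse_of_subdiffusiveBondHeat_horizon ha hq hδ hS (horizonRemainderFloor_of_kernelDecay hpq hK 1) hM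

/-- **KERNEL-DECAY LADDER** (every arrow PROVED): `(KD_p) ⟹ (KD_{p'})` (`p ≤ p'`); `(KD_p) ⟹ (HZᶠ_{q,g})` (`q > p`, all `g`); with the
phonon value `p = 3`: `(KD_3) ∧ (HM_{a,4,δ}) ⟹ LateTailFloor a 1 1 ⟹` (with (S)) 11071. [this cell] -/
theorem kernelDecayLadder {a δ : ℝ} (ha : 0 ≤ a) (hδ : 0 < δ) :
    (∀ p p' : ℝ, p ≤ p' → BathKernelHorizonDecay p → BathKernelHorizonDecay p') ∧
    (∀ (p : ℝ) (q : ℕ) (g : ℝ), p < q → BathKernelHorizonDecay p → HorizonRemainderFloor q g) ∧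
    (BathKernelHorizonDecay 3 → HorizonReturnMonotoneOn a 4 δ → LateTailFloor a 1 1) ∧
    (Theses.BondHeatUncertainty.SubdiffusiveBondHeat → BathKernelHorizonDecay 3 → HorizonReturnMonotoneOn a 4 δ →
      Theses.BondHeatUncertainty.BoundedResponse) :=
  ⟨fun _ _ hpp' h => h.mono hpp', fun _ _ g hpq h => horizonRemainderFloor_of_kernelDecay hpq h g,
    fun hK hM => lateTailFloor_one_of_kernelDecay_horizonMonotone ha (by norm_num) (by norm_num) hδ hK hM,
    fun hS hK hM => boundedResponse_of_subdiffusiveBondHeat_kernelDecay_horizonMonotone ha (by norm_num) (by norm_num) hδ hS hK hM⟩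

end KernelDecay

end Summit.AtomisticToContinuum.FouriersLaw.Theorems.BoundedResponse.HeatSpreading

end
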